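import Literature.NumberTheory.Sieve.QuadraticRootsPrimeModuliDFISieveRough
import HarnessLib

/-!
# Duke–Friedlander–Iwaniec 1995, §6: the terms `y ≤ q < p < z` left alone

Topic `Literature/NumberTheory/Sieve`.  Towards the discharge of
`Literature.NumberTheory.Sieve.dukeFriedlanderIwaniec1995_theorem5` (W. Duke, J. B. Friedlander,
H. Iwaniec, Ann. of Math. 141 (1995), §6 p. 437), continuing `…DFISieveRough`:

* `DFI1995.norm_doubleSum_left_le` — the paper's "if `y = x^{1/3−ε}` then, as long as `z ≤ x^{1/2−ε}`,
  `∑∑_{y≤p<q<z} S(C_{pq}, p) ≪ ∑_{y≤p<x^{1/3}} (x/p)(log(x/p))^{−1} ≪ εx/log x`": here, with the roles of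
  the letters `p, q` as after the exchange of `…DFISieveReindex` (`q` the smaller prime),
  `|∑_{y≤q<z} ∑_{q<p<z} S(C_{pq}, q)| ≤ 8(z+1)² + 160 (x/log x)(12ε + 64/log x)(6ε + 133/log x)` for
  `log y = (1/3 − ε) log x`, `0 < ε ≤ 1/24`, `log x ≥ 16` (the terms `c_{pq}`, `pq < z²`, and
  `c_{pqm}`, `m` prime, `q < x^{1/3}`, counted by Chebyshev and two Mertens windows).

Everything here is proved.

## References

* W. Duke, J. B. Friedlander, H. Iwaniec, Ann. of Math. (2) 141 (1995), 423–441, §6 p. 437 (between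
  Lemma 3 (36) and Theorem 5 (37)). [cite: DukeFriedlanderIwaniec1995, §6 p. 437]
-/

namespace Literature.NumberTheory.Sieve

open scoped BigOperators
open Finset Real

namespace DFI1995

noncomputable section

/-! ### The range `y ≤ q < z` of the double sum -/

set_option maxHeartbeats 400000 in
/-- **The terms `y ≤ q < p < z` left alone** (p. 437): for `|c_n| ≤ τ(n)`, `0 < ε ≤ 1/24`, `1 < x`,
`log x ≥ 16`, `log y = (1/3 − ε) log x` and `0 ≤ z`,
`|∑_{y ≤ q < z} ∑_{w ≤ p < z, q < p} S(C_{pq}, q)| ≤ 8(z + 1)² + 160 (x/log x)(12ε + 64/log x)(6ε + 133/log x)`.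
In `S(C_{pq}, q) = ∑_{(m, P(q)) = 1} c_{pqm}` either `m = 1` (at most `(z+1)²` terms, each `≤ 4`) or
`m` is a prime `≥ q` (as `m < x/q² ≤ q²`), which forces `q³ < x`, `p ≤ x/q²`; these are counted by
Chebyshev (`π(x/pq) ≤ 5 (x/pq)/log q`) and the Mertens windows `∑_{q<p≤x/q²} 1/p ≤ 12ε + 64/log x`,
`∑_{y≤q≤x^{1/3}} 1/q ≤ 6ε + 133/log x`. [cite: DukeFriedlanderIwaniec1995, §6 p. 437] -/
theorem norm_doubleSum_left_le {c : ℕ → ℂ} (hc : ∀ n : ℕ, 1 ≤ n → ‖c n‖ ≤ (Nat.divisors n).card)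
    {x y z w ε : ℝ} (hε : 0 < ε) (hε' : ε ≤ 1 / 24) (hx : 1 < x) (hL : 16 ≤ Real.log x) (hy0 : 0 < y)
    (hy : Real.log y = (1 / 3 - ε) * Real.log x) (hz : 0 ≤ z) :
    ‖∑ q ∈ primesIco y z, ∑ p ∈ (primesIco w z).filter (fun p : ℕ => q < p), siftedQ c x (p * q) q‖ ≤
      8 * (z + 1) ^ 2 + 160 * (x / Real.log x) * (12 * ε + 64 / Real.log x) * (6 * ε + 133 / Real.log x) := by
  classical
  set L := Real.log x with hLdef
  have hL0 : 0 < L := by linarith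
  have hx0 : 0 < x := by linarith
  -- `ℓ = log y ≥ L/4`, `y ≥ 4`
  set ℓ := Real.log y with hℓ
  have hℓL : L / 4 ≤ ℓ := by rw [hy]; nlinarith
  have hℓL' : ℓ < L / 3 := by rw [hy]; nlinarith
  have hy4 : 4 ≤ y := by
    have hlog4 : Real.log 4 ≤ 4 - 1 := Real.log_le_sub_one_of_pos (by norm_num)
    have : Real.log 4 ≤ Real.log y := by linarith
    exact (Real.log_le_log_iff (by norm_num) hy0).1 this
  have hy2 : 2 ≤ y / 2 := by linarith
  set W₀ : ℝ := 12 * ε + 64 / L with hW₀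
  set V₀ : ℝ := 6 * ε + 133 / L with hV₀
  have hW₀0 : 0 ≤ W₀ := by positivity
  have hV₀0 : 0 ≤ V₀ := by positivity
  -- basic facts about `q ∈ primesIco y z`
  have hqfacts : ∀ q ∈ primesIco y z, q.Prime ∧ (2 : ℝ) ≤ q ∧ ℓ ≤ Real.log q ∧ x ≤ (q : ℝ) ^ 4 := by
    intro q hq
    obtain ⟨hqp, hyq, -⟩ := mem_primesIco.1 hq
    have hq2 : (2 : ℝ) ≤ q := by exact_mod_cast hqp.two_le
    have hlogq : ℓ ≤ Real.log q := Real.log_le_log hy0 hyq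
    refine ⟨hqp, hq2, hlogq, ?_⟩
    -- `log x ≤ 4 log q`
    have h4 : Real.log x ≤ Real.log ((q : ℝ) ^ 4) := by
      rw [Real.log_pow]; push_cast
      have : L ≤ 4 * ℓ := by rw [hy]; nlinarith
      linarith
    exact (Real.log_le_log_iff hx0 (by positivity)).1 h4
  -- the sets `M(q, p)` and the counts `N(q, p)`
  set M : ℕ → ℕ → Finset ℕ := fun q p =>
    (Icc 1 (⌊x⌋₊ / (p * q))).filter (fun m : ℕ => m.Coprime (primesProdBelow q)) with hM
  set N : ℕ → ℕ → ℕ := fun q p => ((M q p).filter (fun m : ℕ => m ≠ 1)).card with hN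
  -- members `m ≠ 1` of `M(q, p)` are primes `≥ q` with `q² p ≤ x`
  have hmem : ∀ q ∈ primesIco y z, ∀ p : ℕ, p.Prime → q < p → ∀ m ∈ (M q p).filter (fun m : ℕ => m ≠ 1),
      m.Prime ∧ q ≤ m ∧ m ≤ ⌊x⌋₊ / (p * q) ∧ ((q : ℝ)) ^ 2 * p ≤ x := by
    intro q hq p hp hqp m hm
    obtain ⟨hqprime, hq2, -, hx4⟩ := hqfacts q hq
    simp only [hM, Finset.mem_filter, Finset.mem_Icc] at hm
    obtain ⟨⟨⟨hm1, hmle⟩, hcop⟩, hm1'⟩ := hm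
    have hm_gt : 1 < m := lt_of_le_of_ne hm1 (Ne.symm hm1')
    have hp0 : (0 : ℝ) < p := by exact_mod_cast hp.pos
    have hq0 : (0 : ℝ) < q := by linarith
    have hqp' : (q : ℝ) + 1 ≤ p := by exact_mod_cast hqp
    -- `m ≤ x/(pq)`
    have hmx : (m : ℝ) * ((p : ℝ) * q) ≤ x := by
      have h1 : m * (p * q) ≤ ⌊x⌋₊ := (Nat.le_div_iff_mul_le (Nat.mul_pos hp.pos hqprime.pos)).1 hmle
      have h2 : ((m * (p * q) : ℕ) : ℝ) ≤ x := le_trans (by exact_mod_cast h1) (Nat.floor_le hx0.le)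
      push_cast at h2
      exact h2
    -- `m < q²`
    have hmq2 : (m : ℝ) < (q : ℝ) ^ 2 := by
      by_contra h
      rw [not_lt] at h
      -- then `x ≥ m p q ≥ q² (q+1) q > q⁴ ≥ x`
      have : (q : ℝ) ^ 2 * ((q + 1) * q) ≤ x := by
        calc (q : ℝ) ^ 2 * ((q + 1) * q) ≤ (m : ℝ) * ((p : ℝ) * q) := by
              apply mul_le_mul h (mul_le_mul_of_nonneg_right hqp' hq0.le) (by positivity) (Nat.cast_nonneg m)
          _ ≤ x := hmx
      nlinarith
    have hmprime : m.Prime := prime_of_coprime_primesProdBelow hm_gt hq0.le hcop hmq2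
    have hqm : q ≤ m := by
      have h := le_minFac_of_coprime_primesProdBelow hm_gt hcop
      rw [Nat.Prime.minFac_eq hmprime] at h
      exact_mod_cast h
    refine ⟨hmprime, hqm, hmle, ?_⟩
    have hqm' : (q : ℝ) ≤ m := by exact_mod_cast hqm
    calc (q : ℝ) ^ 2 * p = (q : ℝ) * ((p : ℝ) * q) := by ring
      _ ≤ (m : ℝ) * ((p : ℝ) * q) := mul_le_mul_of_nonneg_right hqm' (by positivity)
      _ ≤ x := hmx
  -- (A1) pointwise: `|S(C_{pq}, q)| ≤ 8 + 8 N(q, p)`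
  have hA1 : ∀ q ∈ primesIco y z, ∀ p : ℕ, p.Prime → q < p →
      ‖siftedQ c x (p * q) q‖ ≤ 8 + 8 * (N q p : ℝ) := by
    intro q hq p hp hqp
    obtain ⟨hqprime, -, -, -⟩ := hqfacts q hq
    rw [siftedQ_eq_sum_filter]
    refine (norm_sum_le _ _).trans ?_
    have hterm : ∀ m ∈ M q p, ‖c (p * q * m)‖ ≤ 8 := by
      intro m hm
      have hm' := hm
      simp only [hM, Finset.mem_filter, Finset.mem_Icc] at hm'
      obtain ⟨⟨hm1, -⟩, -⟩ := hm'
      have hτm : m.divisors.card ≤ 2 := by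
        by_cases h1 : m = 1
        · subst h1; simp
        · have hmp : m.Prime := (hmem q hq p hp hqp m (Finset.mem_filter.2 ⟨hm, h1⟩)).1
          rw [Nat.Prime.divisors hmp, Finset.card_pair hmp.ne_one.symm]
      have hτ : (p * q * m).divisors.card ≤ 8 := by
        calc (p * q * m).divisors.card ≤ (p * q).divisors.card * m.divisors.card := card_divisors_mul_le _ _
          _ ≤ (p.divisors.card * q.divisors.card) * m.divisors.card :=
              Nat.mul_le_mul_right _ (card_divisors_mul_le p q)
          _ ≤ (2 * 2) * 2 := by
              rw [Nat.Prime.divisors hp, Finset.card_pair hp.ne_one.symm, Nat.Prime.divisors hqprime,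
                Finset.card_pair hqprime.ne_one.symm]
              exact Nat.mul_le_mul_left _ hτm
      calc ‖c (p * q * m)‖ ≤ ((p * q * m).divisors.card : ℝ) :=
            hc _ (Nat.mul_pos (Nat.mul_pos hp.pos hqprime.pos) hm1)
        _ ≤ 8 := by exact_mod_cast hτ
    have hcard : ((M q p).card : ℝ) ≤ 1 + N q p := by
      have h := Finset.card_filter_add_card_filter_not (s := M q p) (fun m : ℕ => m ≠ 1)
      have h1 : ((M q p).filter (fun m : ℕ => ¬ m ≠ 1)).card ≤ 1 := by
        refine Finset.card_le_one.2 fun a ha b hb => ?_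
        rw [Finset.mem_filter, not_ne_iff] at ha hb
        rw [ha.2, hb.2]
      have : (M q p).card ≤ 1 + N q p := by
        rw [hN]; dsimp only; omega
      exact_mod_cast this
    calc ∑ m ∈ M q p, ‖c (p * q * m)‖ ≤ ∑ m ∈ M q p, (8 : ℝ) := Finset.sum_le_sum hterm
      _ = 8 * ((M q p).card : ℝ) := by rw [Finset.sum_const, nsmul_eq_mul, mul_comm]
      _ ≤ 8 * (1 + N q p) := by gcongr
      _ = 8 + 8 * (N q p : ℝ) := by ring
  -- (C1) `N(q, p) ≤ 20 x/(p q L)`, and `N(q, p) = 0` unless `q² p ≤ x`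
  have hN0 : ∀ q ∈ primesIco y z, ∀ p : ℕ, p.Prime → q < p → ¬ ((q : ℝ) ^ 2 * p ≤ x) → N q p = 0 := by
    intro q hq p hp hqp hnot
    rw [hN]; dsimp only
    rw [Finset.card_eq_zero, Finset.filter_eq_empty_iff]
    intro m hm hm1
    exact hnot (hmem q hq p hp hqp m (Finset.mem_filter.2 ⟨hm, hm1⟩)).2.2.2
  have hC1 : ∀ q ∈ primesIco y z, ∀ p : ℕ, p.Prime → q < p → (q : ℝ) ^ 2 * p ≤ x →
      (N q p : ℝ) ≤ 20 * x / L * ((p : ℝ)⁻¹ * (q : ℝ)⁻¹) := by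
    intro q hq p hp hqp hqpx
    obtain ⟨hqprime, hq2, hlogq, -⟩ := hqfacts q hq
    have hp0 : (0 : ℝ) < p := by exact_mod_cast hp.pos
    have hq0 : (0 : ℝ) < q := by linarith
    -- `N ≤ π(⌊x⌋/(pq)) = π(⌊x/(pq)⌋)`
    have h1 : N q p ≤ Nat.primeCounting ⌊x / ((p * q : ℕ) : ℝ)⌋₊ := by
      rw [Nat.floor_div_natCast, ← Nat.primesLE_card_eq_primeCounting, hN]
      dsimp only
      refine Finset.card_le_card fun m hm => ?_
      obtain ⟨hmp, -, hmle, -⟩ := hmem q hq p hp hqp m hm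
      exact Nat.mem_primesLE.2 ⟨hmle, hmp⟩
    -- Chebyshev at `t = x/(pq) ≥ q ≥ 2`
    have ht : (q : ℝ) ≤ x / ((p * q : ℕ) : ℝ) := by
      push_cast
      rw [le_div_iff₀ (by positivity)]
      nlinarith
    have ht2 : (2 : ℝ) ≤ x / ((p * q : ℕ) : ℝ) := hq2.trans ht
    have h2 := primeCounting_le_mul_div_log ht2
    have hlogt : L / 4 ≤ Real.log (x / ((p * q : ℕ) : ℝ)) :=
      (hℓL.trans hlogq).trans (Real.log_le_log hq0 ht)
    have hlogt0 : 0 < Real.log (x / ((p * q : ℕ) : ℝ)) := by linarith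
    have hC : 2 * Real.log 4 + 2 ≤ 5 := two_mul_log_four_add_two_le
    calc (N q p : ℝ) ≤ Nat.primeCounting ⌊x / ((p * q : ℕ) : ℝ)⌋₊ := by exact_mod_cast h1
      _ ≤ (2 * Real.log 4 + 2) * (x / ((p * q : ℕ) : ℝ)) / Real.log (x / ((p * q : ℕ) : ℝ)) := h2
      _ ≤ 5 * (x / ((p * q : ℕ) : ℝ)) / (L / 4) := by
          have hxpq : 0 ≤ x / ((p * q : ℕ) : ℝ) := by positivity
          calc (2 * Real.log 4 + 2) * (x / ((p * q : ℕ) : ℝ)) / Real.log (x / ((p * q : ℕ) : ℝ))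
              ≤ 5 * (x / ((p * q : ℕ) : ℝ)) / Real.log (x / ((p * q : ℕ) : ℝ)) := by
                gcongr
            _ ≤ 5 * (x / ((p * q : ℕ) : ℝ)) / (L / 4) := by
                apply div_le_div_of_nonneg_left (by positivity) (by positivity) hlogt
      _ = 20 * x / L * ((p : ℝ)⁻¹ * (q : ℝ)⁻¹) := by
          push_cast; field_simp; norm_num
  -- (D) for each `q`: `∑_{q < p} N(q, p) ≤ (20 x/(qL)) W₀`, and `= 0` unless `q³ ≤ x`
  have hWq : ∀ q ∈ primesIco y z,
      ∑ p ∈ ((primesIco w z).filter (fun p : ℕ => q < p)).filter (fun p : ℕ => (q : ℝ) ^ 2 * p ≤ x),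
        (p : ℝ)⁻¹ ≤ W₀ := by
    intro q hq
    obtain ⟨hqprime, hq2, hlogq, -⟩ := hqfacts q hq
    have hq0 : (0 : ℝ) < q := by linarith
    set S := ((primesIco w z).filter (fun p : ℕ => q < p)).filter (fun p : ℕ => (q : ℝ) ^ 2 * p ≤ x) with hS
    rcases S.eq_empty_or_nonempty with hSe | ⟨p₀, hp₀⟩
    · rw [hSe, Finset.sum_empty]; exact hW₀0
    -- the window `(q, x/q²]`
    have hmemS : ∀ p ∈ S, p.Prime ∧ (q : ℝ) < p ∧ (p : ℝ) ≤ x / (q : ℝ) ^ 2 := by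
      intro p hp
      simp only [hS, Finset.mem_filter, mem_primesIco] at hp
      obtain ⟨⟨⟨hpp, -, -⟩, hqp⟩, hqpx⟩ := hp
      refine ⟨hpp, by exact_mod_cast hqp, ?_⟩
      rw [le_div_iff₀ (by positivity)]; linarith
    obtain ⟨-, hqp₀, hp₀x⟩ := hmemS p₀ hp₀
    have hquv : (q : ℝ) ≤ x / (q : ℝ) ^ 2 := hqp₀.le.trans hp₀x
    have hwin := sum_inv_primes_window_le hq2 hquv hmemS
    refine hwin.trans ?_
    -- `log(x/q²)/log q ≤ (1 + 6ε)/(1 − 3ε)` and `16/log q ≤ 64/L`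
    have hlq0 : 0 < Real.log q := Real.log_pos (by linarith)
    have hratio_pos : 0 < Real.log (x / (q : ℝ) ^ 2) / Real.log q := by
      apply div_pos _ hlq0
      apply Real.log_pos
      rw [lt_div_iff₀ (by positivity)]
      have : (1 : ℝ) * (q : ℝ) ^ 2 < (q : ℝ) * q ^ 2 := by
        apply mul_lt_mul_of_pos_right _ (by positivity); linarith
      nlinarith [hquv, div_mul_cancel₀ x (show ((q : ℝ)) ^ 2 ≠ 0 by positivity)]
    have hratio : Real.log (x / (q : ℝ) ^ 2) / Real.log q ≤ (1 + 6 * ε) / (1 - 3 * ε) := by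
      rw [Real.log_div hx0.ne' (by positivity), Real.log_pow]
      push_cast
      rw [div_le_div_iff₀ hlq0 (by linarith)]
      -- `(L − 2 log q)(1 − 3ε) ≤ (1 + 6ε) log q` iff `(1 − 3ε)L ≤ 3 log q` iff `ℓ ≤ log q`
      have : (1 - 3 * ε) * L ≤ 3 * Real.log q := by rw [hy] at hlogq; nlinarith
      nlinarith
    have hlogratio : Real.log (Real.log (x / (q : ℝ) ^ 2) / Real.log q) ≤ 12 * ε :=
      log_le_twelve_mul hε hε' hratio_pos hratio
    have h16 : 16 / Real.log q ≤ 64 / L := by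
      rw [div_le_div_iff₀ hlq0 hL0]
      linarith [hℓL.trans hlogq]
    rw [hW₀]; linarith
  have hDq : ∀ q ∈ primesIco y z,
      ∑ p ∈ (primesIco w z).filter (fun p : ℕ => q < p), (N q p : ℝ) ≤ 20 * x / L * W₀ * (q : ℝ)⁻¹ := by
    intro q hq
    obtain ⟨hqprime, hq2, -, -⟩ := hqfacts q hq
    have hq0 : (0 : ℝ) < q := by linarith
    -- drop the `p` with `q² p > x` (there `N = 0`), bound the others by (C1)
    have h1 : ∀ p ∈ (primesIco w z).filter (fun p : ℕ => q < p), (N q p : ℝ) ≤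
        if (q : ℝ) ^ 2 * p ≤ x then 20 * x / L * ((p : ℝ)⁻¹ * (q : ℝ)⁻¹) else 0 := by
      intro p hp
      simp only [Finset.mem_filter, mem_primesIco] at hp
      obtain ⟨⟨hpp, -, -⟩, hqp⟩ := hp
      split_ifs with h
      · exact hC1 q hq p hpp hqp h
      · rw [hN0 q hq p hpp hqp h]; simp
    refine (Finset.sum_le_sum h1).trans ?_
    rw [← Finset.sum_filter]
    calc ∑ p ∈ ((primesIco w z).filter (fun p : ℕ => q < p)).filter (fun p : ℕ => (q : ℝ) ^ 2 * p ≤ x),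
          20 * x / L * ((p : ℝ)⁻¹ * (q : ℝ)⁻¹)
        = 20 * x / L * (q : ℝ)⁻¹ * ∑ p ∈ ((primesIco w z).filter (fun p : ℕ => q < p)).filter
            (fun p : ℕ => (q : ℝ) ^ 2 * p ≤ x), (p : ℝ)⁻¹ := by
          rw [Finset.mul_sum]; refine Finset.sum_congr rfl fun p _ => by ring
      _ ≤ 20 * x / L * (q : ℝ)⁻¹ * W₀ := mul_le_mul_of_nonneg_left (hWq q hq) (by positivity)
      _ = 20 * x / L * W₀ * (q : ℝ)⁻¹ := by ring
  have hDq0 : ∀ q ∈ primesIco y z, ¬ ((q : ℝ) ^ 3 ≤ x) →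
      ∑ p ∈ (primesIco w z).filter (fun p : ℕ => q < p), (N q p : ℝ) = 0 := by
    intro q hq hq3
    refine Finset.sum_eq_zero fun p hp => ?_
    simp only [Finset.mem_filter, mem_primesIco] at hp
    obtain ⟨⟨hpp, -, -⟩, hqp⟩ := hp
    have hq0 : (0 : ℝ) ≤ q := Nat.cast_nonneg q
    rw [hN0 q hq p hpp hqp fun h => hq3 ?_]
    · simp
    · have hqp' : (q : ℝ) ≤ p := by exact_mod_cast hqp.le
      calc (q : ℝ) ^ 3 = (q : ℝ) ^ 2 * q := by ring
        _ ≤ (q : ℝ) ^ 2 * p := mul_le_mul_of_nonneg_left hqp' (by positivity)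
        _ ≤ x := h
  -- (E) the sum over `q ≤ x^{1/3}` of `1/q`
  have hV : ∑ q ∈ (primesIco y z).filter (fun q : ℕ => (q : ℝ) ^ 3 ≤ x), (q : ℝ)⁻¹ ≤ V₀ := by
    set v : ℝ := Real.exp (L / 3) with hv
    have hmemS : ∀ q ∈ (primesIco y z).filter (fun q : ℕ => (q : ℝ) ^ 3 ≤ x),
        q.Prime ∧ y / 2 < (q : ℝ) ∧ (q : ℝ) ≤ v := by
      intro q hq
      rw [Finset.mem_filter] at hq
      obtain ⟨hqprime, hq2, -, -⟩ := hqfacts q hq.1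
      obtain ⟨-, hyq, -⟩ := mem_primesIco.1 hq.1
      refine ⟨hqprime, by linarith, ?_⟩
      rw [hv]
      refine (Real.log_le_iff_le_exp (by linarith : (0 : ℝ) < q)).1 ?_
      have h3 : Real.log ((q : ℝ) ^ 3) ≤ L := (Real.log_le_log (by positivity) hq.2)
      rw [Real.log_pow] at h3; push_cast at h3
      linarith
    have hyv : y / 2 ≤ v := by
      rw [hv]
      refine (Real.log_le_iff_le_exp (by linarith : (0 : ℝ) < y / 2)).1 ?_
      rw [Real.log_div hy0.ne' two_ne_zero]
      have h1 : 0 ≤ ε * L := by positivity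
      have h2 : 0 < Real.log 2 := Real.log_pos one_lt_two
      linarith
    have hwin := sum_inv_primes_window_le hy2 hyv hmemS
    refine hwin.trans ?_
    have hlogv : Real.log v = L / 3 := by rw [hv, Real.log_exp]
    have hlogy2 : Real.log (y / 2) = ℓ - Real.log 2 := by rw [Real.log_div hy0.ne' two_ne_zero]
    rw [hlogv, hlogy2, hV₀]
    exact log_window_outer_le hε hε' hL hy
  -- (F) assemble
  have hpairs : ∀ q ∈ primesIco y z, (((primesIco w z).filter (fun p : ℕ => q < p)).card : ℝ) ≤ z + 1 :=
    fun q _ => le_trans (by exact_mod_cast Finset.card_filter_le _ _) (card_primesIco_le hz)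
  have hcardq : ((primesIco y z).card : ℝ) ≤ z + 1 := card_primesIco_le hz
  calc ‖∑ q ∈ primesIco y z, ∑ p ∈ (primesIco w z).filter (fun p : ℕ => q < p), siftedQ c x (p * q) q‖
      ≤ ∑ q ∈ primesIco y z, ∑ p ∈ (primesIco w z).filter (fun p : ℕ => q < p), ‖siftedQ c x (p * q) q‖ :=
        (norm_sum_le _ _).trans (Finset.sum_le_sum fun q _ => norm_sum_le _ _)
    _ ≤ ∑ q ∈ primesIco y z, ∑ p ∈ (primesIco w z).filter (fun p : ℕ => q < p), (8 + 8 * (N q p : ℝ)) := by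
        refine Finset.sum_le_sum fun q hq => Finset.sum_le_sum fun p hp => ?_
        simp only [Finset.mem_filter, mem_primesIco] at hp
        exact hA1 q hq p hp.1.1 hp.2
    _ = ∑ q ∈ primesIco y z, (8 * (((primesIco w z).filter (fun p : ℕ => q < p)).card : ℝ) +
          8 * ∑ p ∈ (primesIco w z).filter (fun p : ℕ => q < p), (N q p : ℝ)) := by
        refine Finset.sum_congr rfl fun q _ => ?_
        rw [Finset.sum_add_distrib, Finset.sum_const, nsmul_eq_mul, Finset.mul_sum]; ring
    _ ≤ ∑ q ∈ primesIco y z, (8 * (z + 1) +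
          8 * (if (q : ℝ) ^ 3 ≤ x then 20 * x / L * W₀ * (q : ℝ)⁻¹ else 0)) := by
        refine Finset.sum_le_sum fun q hq => add_le_add ?_ ?_
        · exact mul_le_mul_of_nonneg_left (hpairs q hq) (by norm_num)
        · refine mul_le_mul_of_nonneg_left ?_ (by norm_num)
          split_ifs with h3
          · exact hDq q hq
          · rw [hDq0 q hq h3]
    _ = 8 * (z + 1) * ((primesIco y z).card : ℝ) +
          8 * (20 * x / L * W₀) * ∑ q ∈ (primesIco y z).filter (fun q : ℕ => (q : ℝ) ^ 3 ≤ x), (q : ℝ)⁻¹ := by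
        rw [Finset.sum_add_distrib, Finset.sum_const, nsmul_eq_mul, Finset.sum_filter, Finset.mul_sum]
        congr 1
        · ring
        · refine Finset.sum_congr rfl fun q _ => ?_
          split_ifs <;> ring
    _ ≤ 8 * (z + 1) * (z + 1) + 8 * (20 * x / L * W₀) * V₀ := by
        have h1 : 8 * (z + 1) * ((primesIco y z).card : ℝ) ≤ 8 * (z + 1) * (z + 1) :=
          mul_le_mul_of_nonneg_left hcardq (by positivity)
        have h2 : 8 * (20 * x / L * W₀) *
            ∑ q ∈ (primesIco y z).filter (fun q : ℕ => (q : ℝ) ^ 3 ≤ x), (q : ℝ)⁻¹ ≤ 8 * (20 * x / L * W₀) * V₀ :=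
          mul_le_mul_of_nonneg_left hV (by positivity)
        linarith
    _ = 8 * (z + 1) ^ 2 + 160 * (x / L) * W₀ * V₀ := by ring

end

end DFI1995

end Literature.NumberTheory.Sieve
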